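import Literature.Geometry.Lorentzian.KerrOblateCalculus
import HarnessLib

/-!
# The null frame of the `(∂_{t*}, ℓ♯)`-plane of the Kerr–Schild chart: the outgoing null vector
# `m = (1 + 2H) ∂_{t*} + (1 − 2H) ℓ⃗`, the ingoing null vector `k = −ℓ♯`, and the null
# decomposition `g⁻¹(p, p) = −p(m) p(k) + |p̸|²` of the inverse Kerr metric

(family `gr`; infrastructure for the far-region `r^p`-weighted estimates of Dafermos–Rodnianski
behind statement **gr.S24** — the named fact `Kerr.dafermosRodnianski_pHierarchy_scri` of
`KerrDecayHierarchy.lean` — in the coefficient-field framework of `KerrSchild.multiplierBulk`;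
namespace `Literature.Geometry.Lorentzian.Kerr`)

The `r^p` method of Dafermos–Rodnianski (arXiv:0910.4957, §3–§4; Moschidis arXiv:1509.08489, §4–§5)
multiplies the wave equation by `r^p ∂_v(rψ)`, `∂_v` the outgoing null derivative, and exploits the
fact that the bulk term of a multiplier `X = f · m` with `m` **null** contains no square of the
transversal (ingoing) derivative: `(𝓛_X g)(m, m) = 2 g(∇_m (f m), m) = f · m(g(m, m)) = 0`. On
Kerr in the ingoing Kerr–Schild chart (`g = η + 2H ℓ ⊗ ℓ`, `ℓ = (1, ℓ⃗)`, `ℓ♯ = (−1, ℓ⃗)`,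
`|ℓ⃗| = 1`; `KerrSchild.lean`) the principal null vector `ℓ♯` is past-directed; `k := −ℓ♯ =
∂_{t*} − ℓ⃗` is the future-directed **ingoing** null vector (geodesic: `∂_{ℓ♯} ℓ = 0`,
`KerrSchildDivergence.lean`), and the second null direction of the timelike plane spanned by
`∂_{t*}` and `ℓ♯` is
`m := 2 ∂_{t*} + (1 − 2H) ℓ♯ = ((1 + 2H), (1 − 2H) ℓ⃗)`,
the future-directed **outgoing** null vector with `g(m, k) = −2` (for `a = 0`:
`m = (1 + 2M/r) ∂_{t*} + (1 − 2M/r) ∂_r`, the outgoing null direction of ingoing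
Eddington–Finkelstein coordinates; for `a ≠ 0` it is *not* the outgoing principal null direction,
which does not lie in this plane, but it is exactly null, which is what the method needs). This
file provides the frame and its algebra:

* `Kerr.outVector M a x` (`m`), `Kerr.bilin_outVector_left` (`g(m, w) = −2w⁰ + (1 + 2H) ℓ(w)`),
  `Kerr.bilin_outVector_outVector` (`g(m, m) = 0`), `Kerr.bilin_outVector_nullVector`
  (`g(m, ℓ♯) = 2`), `Kerr.bilin_nullVector_left` (`g(ℓ♯, w) = ℓ(w)`; `g(ℓ♯, ℓ♯) = 0` is
  `Kerr.bilin_nullVector_nullVector` of `KerrLeafEnergyComparison.lean`),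
  `Kerr.timeVector_eq_outVector_nullVector` (`V = −g♯dt* = ½ m − ½(1 + 2H) ℓ♯`),
  `Kerr.basisVector_zero_eq_outVector_nullVector` (`∂_{t*} = ½ m − ½(1 − 2H) ℓ♯`);
* the **frame functionals** of a covector `p = (p_μ)`: `Kerr.frameOut M a x p = p(m) =
  (1 + 2H) p₀ + (1 − 2H) ℓ⃗·p⃗`, `Kerr.frameIn a x p = p(k) = p₀ − ℓ⃗·p⃗`, the angular pairing
  `Kerr.frameAng a x p q = p⃗·q⃗ − (ℓ⃗·p⃗)(ℓ⃗·q⃗)` (the Euclidean pairing of the parts of `p⃗`, `q⃗`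
  orthogonal to `ℓ⃗`; the `g`-orthogonal complement of `{m, k}` is `{(0, w⃗) : w⃗ ⊥ ℓ⃗}`, on which
  `g` is Euclidean) and `Kerr.frameAngSq a x p = |p⃗|² − (ℓ⃗·p⃗)² = |p̸|² ≥ 0`
  (`Kerr.frameAngSq_nonneg`, `Kerr.frameAngSq_le`);
* **the null decomposition of the inverse metric** (`Kerr.sum_inverseMetric_mul_mul_eq_frame`):
  `∑_{αβ} g^{αβ} p_α q_β = −½ (p(m) q(k) + p(k) q(m)) + (p⃗·q⃗ − (ℓ⃗·p⃗)(ℓ⃗·q⃗))`, i.e.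
  `g⁻¹ = −½ (m ⊗ k + k ⊗ m) + γ⁻¹`; in particular `g⁻¹(p, p) = −p(m) p(k) + |p̸|²`
  (`Kerr.sum_inverseMetric_mul_mul_self_eq_frame`);
* the calculus of `m`: stationarity (`Kerr.outVector_add_smul_basisVector_zero`,
  `Kerr.fderiv_outVector_apply_basisVector_zero`), smoothness (`Kerr.contDiffAt_outVector`), the
  derivative along the congruence `∂_{ℓ♯} m^μ = −2 (∂_{ℓ♯}H) ℓ^μ` (`Kerr.fderiv_outVector_apply_nullVector`,
  from the geodesy `∂_{ℓ♯} ℓ♯ = 0`), and the **divergence**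
  `∑_μ ∂_μ m^μ = (1 − 2H) · 2r/Σ − 2 ∂_{ℓ♯}H` (`Kerr.sum_fderiv_outVector_apply_basisVector`, from
  the expansion `∑_μ ∂_μ ℓ^μ = 2r/Σ` of the congruence, `KerrSchildDivergence.lean`).

All statements are pointwise identities at points with `r > 0`, for all real `M, a`. No named
facts are introduced (D-0026).

## References

* M. Dafermos, I. Rodnianski, *A new physical-space approach to decay for the wave equation with
  applications to black hole spacetimes*, XVIth ICMP (2010), arXiv:0910.4957, §3–§4 (the
  multiplier `r^p ∂_v`, `∂_v` outgoing null) (key `DafermosRodnianski2010ICMP`).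
* G. Moschidis, *The `r^p`-weighted energy method of Dafermos and Rodnianski in general
  asymptotically flat spacetimes and applications*, Ann. PDE 2 (2016), arXiv:1509.08489, §4–§5
  (key `Moschidis2016`).
* R. P. Kerr, A. Schild, 1965, §2 (`g⁻¹ = η⁻¹ − 2H ℓ♯ ⊗ ℓ♯`, the geodesic null congruence)
  (key `KerrSchild1965`).
* M. Visser, *The Kerr spacetime: a brief introduction*, arXiv:0706.0622, (32)–(35), §5
  (key `arXiv07060622`).
-/

noncomputable section

open Set Filter
open scoped Topology

namespace Literature.Geometry.Lorentzian.Kerr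

variable {M a : ℝ} {x : E4}

/-! ### The outgoing null vector `m = 2∂_{t*} + (1 − 2H) ℓ♯` -/

/-- The **outgoing null vector of the `(∂_{t*}, ℓ♯)`-plane** of the Kerr–Schild chart:
`m = 2 ∂_{t*} + (1 − 2H) ℓ♯`, with components `((1 + 2H), (1 − 2H) ℓ⃗)`. It is `g`-null,
future-directed, and `g(m, −ℓ♯) = −2` (`bilin_outVector_outVector`, `bilin_outVector_nullVector`);
for `a = 0` it is `(1 + 2M/r) ∂_{t*} + (1 − 2M/r) ∂_r`, the outgoing null direction of the ingoing
Eddington–Finkelstein chart, i.e. a multiple of the vector `∂_v` of the `r^p` multiplier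
`r^p ∂_v` of Dafermos–Rodnianski. [cite: DafermosRodnianski2010ICMP, §4] -/
def outVector (M a : ℝ) (x : E4) : E4 :=
  (2 : ℝ) • E4.basisVector 0 + (1 - 2 * scalarH M a x) • nullVector a x

/-- Components: `m^μ = 2δ^μ_0 + (1 − 2H)(ℓ♯)^μ`. [folklore] -/
theorem outVector_apply (M a : ℝ) (x : E4) (μ : Fin 4) :
    outVector M a x μ = (if μ = 0 then 2 else 0) + (1 - 2 * scalarH M a x) * nullVector a x μ := by
  by_cases hμ : μ = 0
  · subst hμ; simp [outVector, E4.basisVector]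
  · simp [outVector, E4.basisVector, hμ]

/-- `m⁰ = 1 + 2H`. [folklore] -/
@[simp]
theorem outVector_apply_zero (M a : ℝ) (x : E4) : outVector M a x 0 = 1 + 2 * scalarH M a x := by
  rw [outVector_apply, if_pos rfl, nullVector_apply_zero]; ring

/-- `m¹ = (1 − 2H) ℓ₁`. [folklore] -/
@[simp]
theorem outVector_apply_one (M a : ℝ) (x : E4) :
    outVector M a x 1 = (1 - 2 * scalarH M a x) * nullCovectorFun a x 1 := by
  rw [outVector_apply, if_neg (by decide), nullVector_apply_one, zero_add]

/-- `m² = (1 − 2H) ℓ₂`. [folklore] -/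
@[simp]
theorem outVector_apply_two (M a : ℝ) (x : E4) :
    outVector M a x 2 = (1 - 2 * scalarH M a x) * nullCovectorFun a x 2 := by
  rw [outVector_apply, if_neg (by decide), nullVector_apply_two, zero_add]

/-- `m³ = (1 − 2H) ℓ₃`. [folklore] -/
@[simp]
theorem outVector_apply_three (M a : ℝ) (x : E4) :
    outVector M a x 3 = (1 - 2 * scalarH M a x) * nullCovectorFun a x 3 := by
  rw [outVector_apply, if_neg (by decide), nullVector_apply_three, zero_add]

/-- The spatial components: `m^{i+1} = (1 − 2H) ℓ_{i+1}`. [folklore] -/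
theorem outVector_apply_succ (M a : ℝ) (x : E4) (i : Fin 3) :
    outVector M a x i.succ = (1 - 2 * scalarH M a x) * nullCovectorFun a x i.succ := by
  rw [outVector_apply, if_neg (Fin.succ_ne_zero i), nullVector_apply, if_neg (Fin.succ_ne_zero i),
    zero_add, one_mul]

/-- `ℓ(m) = 2` (`ℓ(∂_{t*}) = 1`, `ℓ(ℓ♯) = 0`). [cite: KerrSchild1965, §2] -/
theorem nullCovector_outVector (M : ℝ) (hx : 0 < radius a x) :
    nullCovector a x (outVector M a x) = 2 := by
  simp only [outVector, map_add, map_smul, smul_eq_mul, nullCovector_basisVector_zero,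
    nullCovector_nullVector hx]
  ring

/-- **`g(m, w) = −2 w⁰ + (1 + 2H) ℓ(w)`** for the Kerr–Schild metric `g = η + 2H ℓ ⊗ ℓ`
(`g(∂_{t*}, w) = −w⁰ + 2H ℓ(w)`, `g(ℓ♯, w) = ℓ(w)`). [cite: KerrSchild1965, §2] -/
theorem bilin_outVector_left (hx : 0 < radius a x) (w : E4) :
    bilin M a x (outVector M a x) w = -2 * w 0 + (1 + 2 * scalarH M a x) * nullCovector a x w := by
  simp only [outVector, map_add, map_smul, smul_eq_mul, add_apply, FunLike.coe_smul, Pi.smul_apply,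
    bilin_apply, bilin_nullVector, nullCovector_nullVector hx, nullCovector_basisVector_zero,
    Minkowski.bilin_basisVector_zero_left]
  ring

/-- **`m` is null: `g(m, m) = 0`** (`−2(1 + 2H) + (1 + 2H) ℓ(m)` with `ℓ(m) = 2`).
[cite: DafermosRodnianski2010ICMP, §4] -/
theorem bilin_outVector_outVector (hx : 0 < radius a x) :
    bilin M a x (outVector M a x) (outVector M a x) = 0 := by
  rw [bilin_outVector_left hx, nullCovector_outVector M hx, outVector_apply_zero]
  ring

/-- **`g(m, ℓ♯) = 2`**, i.e. `g(m, k) = −2` for the ingoing null vector `k = −ℓ♯`.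
[cite: DafermosRodnianski2010ICMP, §4] -/
theorem bilin_outVector_nullVector (hx : 0 < radius a x) :
    bilin M a x (outVector M a x) (nullVector a x) = 2 := by
  rw [bilin_outVector_left hx, nullCovector_nullVector hx, nullVector_apply_zero]
  ring

/-- `g(ℓ♯, w) = ℓ(w)` (so `g(k, w) = −ℓ(w)` for `k = −ℓ♯`). [cite: KerrSchild1965, §2] -/
theorem bilin_nullVector_left (M : ℝ) (hx : 0 < radius a x) (w : E4) :
    bilin M a x (nullVector a x) w = nullCovector a x w := by
  rw [bilin_apply, bilin_nullVector, nullCovector_nullVector hx]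
  ring

/-- **`V = −g♯dt* = ½ m − ½(1 + 2H) ℓ♯`**: the Kerr–Schild field `V = ∂_{t*} − 2H ℓ♯`
(`Kerr.timeVector`) in the null frame, `V = ½ m + ½(1 + 2H) k`. [folklore] -/
theorem timeVector_eq_outVector_nullVector (M a : ℝ) (x : E4) :
    timeVector M a x =
      (1 / 2 : ℝ) • outVector M a x - ((1 + 2 * scalarH M a x) / 2) • nullVector a x := by
  ext μ
  simp only [timeVector, outVector, PiLp.sub_apply, PiLp.add_apply, PiLp.smul_apply, smul_eq_mul]
  ring

/-- **`∂_{t*} = ½ m − ½(1 − 2H) ℓ♯`**, i.e. `∂_{t*} = ½ m + ½(1 − 2H) k`. [folklore] -/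
theorem basisVector_zero_eq_outVector_nullVector (M a : ℝ) (x : E4) :
    E4.basisVector 0 =
      (1 / 2 : ℝ) • outVector M a x - ((1 - 2 * scalarH M a x) / 2) • nullVector a x := by
  ext μ
  simp only [outVector, PiLp.sub_apply, PiLp.add_apply, PiLp.smul_apply, smul_eq_mul]
  ring

/-! ### The frame functionals of a covector and the null decomposition of `g⁻¹` -/

/-- The **outgoing frame component** `p(m) = ∑_μ m^μ p_μ = (1 + 2H) p₀ + (1 − 2H) ℓ⃗·p⃗` of a
covector `p = (p_μ)` (for `p = dψ`: the outgoing null derivative `mψ`, a multiple of the `∂_vψ`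
of Dafermos–Rodnianski). [cite: DafermosRodnianski2010ICMP, §3] -/
def frameOut (M a : ℝ) (x : E4) (p : Fin 4 → ℝ) : ℝ := ∑ μ, outVector M a x μ * p μ

/-- The **ingoing frame component** `p(k) = p₀ − ℓ⃗·p⃗ = −p(ℓ♯)` of a covector `p` (`k = −ℓ♯`;
for `p = dψ`: the ingoing null derivative `kψ`, a multiple of `∂_uψ`).
[cite: DafermosRodnianski2010ICMP, §3] -/
def frameIn (a : ℝ) (x : E4) (p : Fin 4 → ℝ) : ℝ := -∑ μ, nullVector a x μ * p μ

/-- `ℓ⃗·p⃗ = ∑_i ℓ_{i+1} p_{i+1}`: the component of the spatial part of `p` along the unit vector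
`ℓ⃗`. [folklore] -/
def spatialDotNull (a : ℝ) (x : E4) (p : Fin 4 → ℝ) : ℝ :=
  ∑ i : Fin 3, nullCovectorFun a x i.succ * p i.succ

/-- The **angular pairing** `p̸·q̸ = p⃗·q⃗ − (ℓ⃗·p⃗)(ℓ⃗·q⃗)` of two covectors: the Euclidean
pairing of the parts of `p⃗`, `q⃗` orthogonal to `ℓ⃗` (the `g`-orthogonal complement of the null
pair `{m, k}` is `{(0, w⃗) : w⃗ ⊥ ℓ⃗}`, on which `g` is the Euclidean metric). For `p = q = dψ`
this is `|∇̸ψ|²`. [cite: DafermosRodnianski2010ICMP, §3] -/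
def frameAng (a : ℝ) (x : E4) (p q : Fin 4 → ℝ) : ℝ :=
  (∑ i : Fin 3, p i.succ * q i.succ) - spatialDotNull a x p * spatialDotNull a x q

/-- The **angular square** `|p̸|² = |p⃗|² − (ℓ⃗·p⃗)²` (`= frameAng a x p p`).
[cite: DafermosRodnianski2010ICMP, §3] -/
def frameAngSq (a : ℝ) (x : E4) (p : Fin 4 → ℝ) : ℝ :=
  (∑ i : Fin 3, p i.succ ^ 2) - spatialDotNull a x p ^ 2

/-- `frameAng a x p p = frameAngSq a x p`. [folklore] -/
theorem frameAng_self (a : ℝ) (x : E4) (p : Fin 4 → ℝ) : frameAng a x p p = frameAngSq a x p := by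
  simp only [frameAng, frameAngSq, sq]

/-- `frameAng` is symmetric. [folklore] -/
theorem frameAng_comm (a : ℝ) (x : E4) (p q : Fin 4 → ℝ) : frameAng a x p q = frameAng a x q p := by
  simp only [frameAng, mul_comm]

/-- `ℓ⃗·p⃗` written out. [folklore] -/
theorem spatialDotNull_eq (a : ℝ) (x : E4) (p : Fin 4 → ℝ) :
    spatialDotNull a x p =
      nullCovectorFun a x 1 * p 1 + nullCovectorFun a x 2 * p 2 + nullCovectorFun a x 3 * p 3 := by
  simp only [spatialDotNull, Fin.sum_univ_three, Fin.succ_zero_eq_one, Fin.succ_one_eq_two,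
    fin_succ_two_eq_three]

/-- `p(m) = (1 + 2H) p₀ + (1 − 2H) ℓ⃗·p⃗` written out. [folklore] -/
theorem frameOut_eq (M a : ℝ) (x : E4) (p : Fin 4 → ℝ) :
    frameOut M a x p = (1 + 2 * scalarH M a x) * p 0 + (1 - 2 * scalarH M a x) * spatialDotNull a x p := by
  simp only [frameOut, spatialDotNull_eq, Fin.sum_univ_four, outVector_apply_zero, outVector_apply_one,
    outVector_apply_two, outVector_apply_three]
  ring

/-- `p(k) = p₀ − ℓ⃗·p⃗` written out. [folklore] -/
theorem frameIn_eq (a : ℝ) (x : E4) (p : Fin 4 → ℝ) : frameIn a x p = p 0 - spatialDotNull a x p := by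
  simp only [frameIn, spatialDotNull_eq, Fin.sum_univ_four, nullVector_apply_zero, nullVector_apply_one,
    nullVector_apply_two, nullVector_apply_three]
  ring

/-- `p(ℓ♯) = −p(k)`: the pairing with the Kerr–Schild null vector is minus the ingoing component.
[folklore] -/
theorem sum_nullVector_mul_eq_neg_frameIn (a : ℝ) (x : E4) (p : Fin 4 → ℝ) :
    ∑ μ, nullVector a x μ * p μ = -frameIn a x p := by
  rw [frameIn, neg_neg]

/-- `p₀ = ½ p(m) + ½ (1 − 2H) p(k)` (`∂_{t*} = ½ m + ½(1 − 2H) k`). [folklore] -/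
theorem apply_zero_eq_frame (M a : ℝ) (x : E4) (p : Fin 4 → ℝ) :
    p 0 = 2⁻¹ * frameOut M a x p + (1 - 2 * scalarH M a x) / 2 * frameIn a x p := by
  rw [frameOut_eq, frameIn_eq]; ring

/-- `ℓ⃗·p⃗ = ½ p(m) − ½ (1 + 2H) p(k)`. [folklore] -/
theorem spatialDotNull_eq_frame (M a : ℝ) (x : E4) (p : Fin 4 → ℝ) :
    spatialDotNull a x p = 2⁻¹ * frameOut M a x p - (1 + 2 * scalarH M a x) / 2 * frameIn a x p := by
  rw [frameOut_eq, frameIn_eq]; ring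

/-- `V(p) := ∑ V^μ p_μ = ½ p(m) + ½ (1 + 2H) p(k)` for `V = Kerr.timeVector`. [folklore] -/
theorem sum_timeVector_mul_eq_frame (M a : ℝ) (x : E4) (p : Fin 4 → ℝ) :
    ∑ μ, timeVector M a x μ * p μ = 2⁻¹ * frameOut M a x p + (1 + 2 * scalarH M a x) / 2 * frameIn a x p := by
  have h : ∀ μ, timeVector M a x μ = (1 / 2 : ℝ) * outVector M a x μ -
      (1 + 2 * scalarH M a x) / 2 * nullVector a x μ := fun μ ↦ by
    rw [timeVector_eq_outVector_nullVector]; simp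
  simp only [h, sub_mul, Finset.sum_sub_distrib, mul_assoc, ← Finset.mul_sum, frameOut, frameIn]
  ring

/-- **The angular square is nonnegative**: `(ℓ⃗·p⃗)² ≤ |p⃗|²` (Cauchy–Schwarz with the unit vector
`ℓ⃗`, via Lagrange's identity). [folklore] -/
theorem frameAngSq_nonneg (hx : 0 < radius a x) (p : Fin 4 → ℝ) : 0 ≤ frameAngSq a x p := by
  have hl := sum_sq_nullCovectorFun hx
  rw [frameAngSq, spatialDotNull_eq, Fin.sum_univ_three]
  simp only [Fin.succ_zero_eq_one, Fin.succ_one_eq_two, fin_succ_two_eq_three]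
  set l₁ := nullCovectorFun a x 1
  set l₂ := nullCovectorFun a x 2
  set l₃ := nullCovectorFun a x 3
  have hlag : (p 1 ^ 2 + p 2 ^ 2 + p 3 ^ 2) * (l₁ ^ 2 + l₂ ^ 2 + l₃ ^ 2) -
      (l₁ * p 1 + l₂ * p 2 + l₃ * p 3) ^ 2 =
        (l₁ * p 2 - l₂ * p 1) ^ 2 + (l₁ * p 3 - l₃ * p 1) ^ 2 + (l₂ * p 3 - l₃ * p 2) ^ 2 := by
    ring
  rw [hl, mul_one] at hlag
  nlinarith [hlag, sq_nonneg (l₁ * p 2 - l₂ * p 1), sq_nonneg (l₁ * p 3 - l₃ * p 1),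
    sq_nonneg (l₂ * p 3 - l₃ * p 2)]

/-- The angular square is at most the spatial square: `|p̸|² ≤ |p⃗|²`. [folklore] -/
theorem frameAngSq_le (a : ℝ) (x : E4) (p : Fin 4 → ℝ) :
    frameAngSq a x p ≤ ∑ i : Fin 3, p i.succ ^ 2 := by
  rw [frameAngSq]
  linarith [sq_nonneg (spatialDotNull a x p)]

/-- **The null decomposition of the inverse Kerr metric** (`g⁻¹ = −½(m ⊗ k + k ⊗ m) + γ⁻¹`): for
covectors `p`, `q`,
`∑_{αβ} g^{αβ} p_α q_β = −½ (p(m) q(k) + p(k) q(m)) + (p⃗·q⃗ − (ℓ⃗·p⃗)(ℓ⃗·q⃗))`,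
a polynomial identity in the components given `g^{αβ} = η^{αβ} − 2H ℓ^α ℓ^β` and `ℓ♯ = (−1, ℓ⃗)`
(the normalisation `|ℓ⃗| = 1` is not even needed). This is the frame form of `g⁻¹` used by the `r^p` method (Dafermos–Rodnianski
arXiv:0910.4957, §3: `□ = −∂_u∂_v + ∇̸²`-type decompositions). [cite: DafermosRodnianski2010ICMP, §3] -/
theorem sum_inverseMetric_mul_mul_eq_frame (M a : ℝ) (x : E4) (p q : Fin 4 → ℝ) :
    ∑ α, ∑ β, inverseMetric M a x α β * p α * q β =
      -2⁻¹ * (frameOut M a x p * frameIn a x q + frameIn a x p * frameOut M a x q) + frameAng a x p q := by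
  rw [frameAng, frameOut_eq, frameOut_eq, frameIn_eq, frameIn_eq, spatialDotNull_eq, spatialDotNull_eq]
  simp only [Fin.sum_univ_four, Fin.sum_univ_three, Fin.succ_zero_eq_one, Fin.succ_one_eq_two,
    fin_succ_two_eq_three, inverseMetric_apply, nullVector_apply_zero, nullVector_apply_one,
    nullVector_apply_two, nullVector_apply_three, Fin.isValue]
  simp only [show (1 : Fin 4) ≠ 0 from by decide, show (2 : Fin 4) ≠ 0 from by decide,
    show (3 : Fin 4) ≠ 0 from by decide, show (0 : Fin 4) ≠ 1 from by decide,
    show (0 : Fin 4) ≠ 2 from by decide, show (0 : Fin 4) ≠ 3 from by decide,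
    show (1 : Fin 4) ≠ 2 from by decide, show (1 : Fin 4) ≠ 3 from by decide,
    show (2 : Fin 4) ≠ 1 from by decide, show (2 : Fin 4) ≠ 3 from by decide,
    show (3 : Fin 4) ≠ 1 from by decide, show (3 : Fin 4) ≠ 2 from by decide, if_true, if_false]
  ring

/-- **`g⁻¹(p, p) = −p(m) p(k) + |p̸|²`**: the quadratic form of the inverse Kerr metric in the null
frame (no `p(k)²` and no `p(m)²` term). [cite: DafermosRodnianski2010ICMP, §3] -/
theorem sum_inverseMetric_mul_mul_self_eq_frame (M a : ℝ) (x : E4) (p : Fin 4 → ℝ) :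
    ∑ α, ∑ β, inverseMetric M a x α β * p α * p β =
      -(frameOut M a x p * frameIn a x p) + frameAngSq a x p := by
  rw [sum_inverseMetric_mul_mul_eq_frame, frameAng_self]
  ring

/-- The raised covector paired with another covector, frame form with the roles of `p` and `q`
displayed: `∑_μ (∑_ν g^{μν} p_ν) q_μ = −½ (p(m) q(k) + p(k) q(m)) + p̸·q̸`. [folklore] -/
theorem sum_sum_inverseMetric_mul_mul_eq_frame (M a : ℝ) (x : E4) (p q : Fin 4 → ℝ) :
    ∑ μ, (∑ ν, inverseMetric M a x μ ν * p ν) * q μ =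
      -2⁻¹ * (frameOut M a x p * frameIn a x q + frameIn a x p * frameOut M a x q) + frameAng a x p q := by
  rw [← sum_inverseMetric_mul_mul_eq_frame M a x p q]
  simp only [Finset.sum_mul]
  rw [Finset.sum_comm]
  refine Finset.sum_congr rfl fun α _ ↦ Finset.sum_congr rfl fun β _ ↦ ?_
  rw [inverseMetric_symm]

/-! ### Calculus of the outgoing null vector: stationarity, smoothness, `∂_{ℓ♯} m`, `div m` -/

/-- `m` is invariant under `t*`-translations. [folklore] -/
theorem outVector_add_smul_basisVector_zero (M a : ℝ) (x : E4) (t : ℝ) :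
    outVector M a (x + t • E4.basisVector 0) = outVector M a x := by
  simp only [outVector, scalarH_add_smul_basisVector_zero, nullVector_add_smul_basisVector_zero]

/-- `x ↦ m_x` is `C^n` wherever `r > 0`. [folklore] -/
theorem contDiffAt_outVector (M a : ℝ) (hx : 0 < radius a x) {n : WithTop ℕ∞} :
    ContDiffAt ℝ n (outVector M a) x := by
  unfold outVector
  exact contDiffAt_const.add ((contDiffAt_const.sub (contDiffAt_const.mul
    (contDiffAt_scalarH M a hx))).smul (contDiffAt_nullVector a hx))

/-- The components `x ↦ m^μ_x` are `C^n` wherever `r > 0`. [folklore] -/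
theorem contDiffAt_outVector_apply (M a : ℝ) (hx : 0 < radius a x) {n : WithTop ℕ∞} (μ : Fin 4) :
    ContDiffAt ℝ n (fun y ↦ outVector M a y μ) x :=
  (contDiffAt_euclidean.1 (contDiffAt_outVector M a hx)) μ

/-- The components `x ↦ (ℓ♯)^μ_x` are `C^n` wherever `r > 0`. [folklore] -/
theorem contDiffAt_nullVector_apply (a : ℝ) (hx : 0 < radius a x) {n : WithTop ℕ∞} (μ : Fin 4) :
    ContDiffAt ℝ n (fun y ↦ nullVector a y μ) x :=
  (contDiffAt_euclidean.1 (contDiffAt_nullVector a hx)) μ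

/-- **Product rule for the components of `m`**:
`∂_v m^μ = −2 (∂_v H) (ℓ♯)^μ + (1 − 2H) ∂_v (ℓ♯)^μ`. [folklore] -/
theorem fderiv_outVector_apply (M a : ℝ) (hx : 0 < radius a x) (v : E4) (μ : Fin 4) :
    fderiv ℝ (fun y ↦ outVector M a y μ) x v =
      -2 * fderiv ℝ (scalarH M a) x v * nullVector a x μ +
        (1 - 2 * scalarH M a x) * fderiv ℝ (fun y ↦ nullVector a y μ) x v := by
  have hfun : (fun y ↦ outVector M a y μ) =
      fun y ↦ (if μ = 0 then (2 : ℝ) else 0) + (1 - 2 * scalarH M a y) * nullVector a y μ := by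
    funext y; exact outVector_apply M a y μ
  have hH : DifferentiableAt ℝ (scalarH M a) x :=
    (contDiffAt_scalarH M a hx (n := 1)).differentiableAt one_ne_zero
  have hl : DifferentiableAt ℝ (fun y ↦ nullVector a y μ) x :=
    (contDiffAt_nullVector_apply a hx (n := 1) μ).differentiableAt one_ne_zero
  have h : HasFDerivAt
      (fun y ↦ (if μ = 0 then (2 : ℝ) else 0) + (1 - 2 * scalarH M a y) * nullVector a y μ)
      ((1 - 2 * scalarH M a x) • fderiv ℝ (fun y ↦ nullVector a y μ) x +
        nullVector a x μ • ((0 : E4 →L[ℝ] ℝ) - (2 : ℝ) • fderiv ℝ (scalarH M a) x)) x :=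
    (((hasFDerivAt_const _ _).sub (hH.hasFDerivAt.const_mul 2)).mul hl.hasFDerivAt).const_add _
  rw [hfun, h.fderiv]
  simp only [add_apply, sub_apply, FunLike.coe_smul, Pi.smul_apply, smul_eq_mul,
    zero_apply]
  ring

/-- **`∂_{t*} m = 0`** (stationarity, differentiated). [folklore] -/
theorem fderiv_outVector_apply_basisVector_zero (M a : ℝ) (hx : 0 < radius a x) (μ : Fin 4) :
    fderiv ℝ (fun y ↦ outVector M a y μ) x (E4.basisVector 0) = 0 := by
  have hd : DifferentiableAt ℝ (fun y ↦ outVector M a y μ) x :=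
    (contDiffAt_outVector_apply M a hx (n := 1) μ).differentiableAt one_ne_zero
  have h1 : HasLineDerivAt ℝ (fun y ↦ outVector M a y μ)
      (fderiv ℝ (fun y ↦ outVector M a y μ) x (E4.basisVector 0)) x (E4.basisVector 0) :=
    hd.hasFDerivAt.hasLineDerivAt _
  have h2 : HasLineDerivAt ℝ (fun y ↦ outVector M a y μ) 0 x (E4.basisVector 0) := by
    have hev : (fun t : ℝ ↦ outVector M a (x + t • E4.basisVector 0) μ) = fun _ ↦ outVector M a x μ := by
      funext t; rw [outVector_add_smul_basisVector_zero]
    show HasDerivAt (fun t : ℝ ↦ outVector M a (x + t • E4.basisVector 0) μ) 0 0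
    rw [hev]
    exact hasDerivAt_const _ _
  exact h1.unique h2

/-- **`∂_{ℓ♯} m^μ = −2 (∂_{ℓ♯} H) (ℓ♯)^μ`**: along the null congruence only the factor `1 − 2H`
varies (geodesy `∂_{ℓ♯} ℓ♯ = 0`, `Kerr.fderiv_nullVector_apply_nullVector`).
[cite: KerrSchild1965, §2] -/
theorem fderiv_outVector_apply_nullVector (M a : ℝ) (hx : 0 < radius a x) (μ : Fin 4) :
    fderiv ℝ (fun y ↦ outVector M a y μ) x (nullVector a x) =
      -2 * fderiv ℝ (scalarH M a) x (nullVector a x) * nullVector a x μ := by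
  rw [fderiv_outVector_apply M a hx, fderiv_nullVector_apply_nullVector hx]
  ring

/-- Linearity bookkeeping: `∑_μ (ℓ♯)^μ ∂_μ F = ∂_{ℓ♯} F` for a function differentiable at `x`.
[folklore] -/
theorem sum_nullVector_mul_fderiv_basisVector {F : E4 → ℝ} (a : ℝ) (x : E4) :
    ∑ μ, nullVector a x μ * fderiv ℝ F x (E4.basisVector μ) = fderiv ℝ F x (nullVector a x) := by
  conv_rhs => rw [eq_sum_basisVector (nullVector a x)]
  simp only [map_sum, map_smul, smul_eq_mul]

/-- **The divergence of the outgoing null vector**: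
`∑_μ ∂_μ m^μ = (1 − 2H) · (2r/Σ) − 2 ∂_{ℓ♯} H`, from `m = 2∂_{t*} + (1 − 2H) ℓ♯`, the expansion
`∑_μ ∂_μ ℓ^μ = 2r/Σ` of the Kerr–Schild congruence and `∑_μ ℓ^μ ∂_μ H = ∂_{ℓ♯} H`
(`= M(Σ − 2r²)/Σ²`, `Kerr.fderiv_scalarH_nullVector`). For `a = 0`: `div m = 2(1 − 2M/r)/r + 2M/r²`.
[cite: arXiv07060622, §5] -/
theorem sum_fderiv_outVector_apply_basisVector (M a : ℝ) (hx : 0 < radius a x) :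
    ∑ μ, fderiv ℝ (fun y ↦ outVector M a y μ) x (E4.basisVector μ) =
      (1 - 2 * scalarH M a x) * (2 * radius a x / blSigma a (E4.spatial x)) -
        2 * fderiv ℝ (scalarH M a) x (nullVector a x) := by
  simp only [fderiv_outVector_apply M a hx, Finset.sum_add_distrib]
  have h1 : ∑ μ, -2 * fderiv ℝ (scalarH M a) x (E4.basisVector μ) * nullVector a x μ =
      -2 * fderiv ℝ (scalarH M a) x (nullVector a x) := by
    rw [← sum_nullVector_mul_fderiv_basisVector a x, Finset.mul_sum]
    refine Finset.sum_congr rfl fun μ _ ↦ by ring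
  have h2 : ∑ μ, (1 - 2 * scalarH M a x) * fderiv ℝ (fun y ↦ nullVector a y μ) x (E4.basisVector μ) =
      (1 - 2 * scalarH M a x) * (2 * radius a x / blSigma a (E4.spatial x)) := by
    rw [← Finset.mul_sum, sum_fderiv_nullVector_basisVector hx]
  rw [h1, h2]
  ring

end Literature.Geometry.Lorentzian.Kerr
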